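import Literature.AnabelianGeometry.EtaleTheta.BiKummerThm44SubModelWeak
import Literature.AnabelianGeometry.EtaleTheta.BiKummerThm44SubNHSatRootsReading

/-!
# [EtTh] Theorem 4.4 at the WEAK monoid vocabulary AT THE ROOTS READING of the `(N, H_⊙^{bs-fld})`-saturation slot:
# T44-L15b discharged too — Thm 4.4 at the genuine connected base modulo `Remark372` and `hBmon` ONLY; proof-only

S. Mochizuki, *The étale theta function …*, Publ. RIMS **45** (2009) [MochizukiEtTh2009], §4, Thm 4.4 (PDF pp.93–95),
proof p.95 ll.14–16 («the "manifestly category-theoretic nature" of "`(N, H^{bs-fld}_{⊙,i})`-saturation" [cf. [FrdII],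
Definition 2.2, (ii); [AbsAnab], Lemma 1.3.8]»).

abc-iut cell, layer L2, sub-DAG `plan/L2/SUBDAG-EtTh-Thm44.md` (custodian abc-iut-w5-d179).  PROOF-ONLY companion
(seat abc-iut-w6-d037, gen 2): no definition, no named fact, nothing restated.  Composition of
* this seat's `BiKummerThm44SubModelWeak.lean` (the Thm 4.4 chain at `treeMonoidVocabWeak`, the vocabulary of the
  coverings `Ÿ`, `Z_∞` where [FrdI] Def 2.4 (i)(d) fails — finding F-L2d2-1; consolidated theorem modulo
  {`Remark372` ×2, `hBmon` ×2, T44-L15b}), with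
* abc-iut-w4-d044's `Thm44Hyp.preservesNHSaturatedBsFld_rootsReading` (`BiKummerThm44SubNHSatRootsReading.lean`,
  vocabulary-generic): T44-L15b PROVED when both settings carry the ROOTS READING of the free
  `(N, H_⊙^{bs-fld})`-saturation slot — `NH_i A N := ∀ (g : A^bs ⟶ A_{⊙,i}^bs) (ξ ∈ B_i(A_{⊙,i}^bs)), Div_B ξ = 1 →
  ∃ ζ ∈ B_i(A^bs), ζ^N = B_i(g)(ξ)` (HONEST LABEL, as there: a reading WEAKER than print's cohomological [FrdII]
  Def 2.2 (ii)(c); exactly what Prop 4.2 (iv) uses; at the faithful reading T44-L15b stays the [FrdII]/[AbsAnab]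
  input).
Results:
* `Thm44Hyp.preservesNthRoots_mkOfModelCanonical_rootsReading_treeVocabWeak` — T44-L14 at the canonical weak-vocabulary
  models at the roots reading ⇐ {`Remark372 D₀ / D₀'`, `hBmon₁ / hBmon₂`, T44-L09c `GaloisCompatible`} (weak twin of
  abc-iut-w4-d044's `preservesNthRoots_mkOfModelCanonical_rootsReading`, WITHOUT its perf-factorial binder);
* `Thm44Hyp.thm44_mkOfModelCanonical_rootsReading_treeVocabWeak` — (i) ∧ (ii) ∧ (iii) ∧ (`N`-th roots) there ⇐
  {`Remark372` ×2, `hBmon` ×2, T44-L09c, T44-L09};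
* **`Thm44Hyp.thm44_mkOfConnectedTemperoid_rootsReading_treeVocabWeak`** — at the GENUINE connected base
  `B^temp(Π^tp_X)⁰` (abc-iut-L2-t4's `mkOfConnectedTemperoid`, whose saturation slot is the free parameter `NH`, here
  the roots reading; T44-L09 / T44-L09c are abc-iut-w5-d013's theorems, [SemiAnbd] Prop 3.2):
  **[EtTh] Thm 4.4 (i) ∧ (ii) ∧ (iii) ∧ (`N`-th roots) ⇐ {`Remark372 D₀ / D₀'` (Rmk 3.7.2, named fact), `hBmon₁ / hBmon₂`
  (Def 3.6 (ii) datum "`𝔹` a monoid on `D`")} ONLY** — every other printed input of the proof on p.95 ([FrdI] Thm 3.4,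
  Cor 4.10 + Prop 2.2 (ii), Thm 4.2 (ii), Cor 5.7; [FrdII] Def 2.2 (ii) at the roots reading; [SemiAnbd] Prop 3.2;
  [EtTh] Thm 3.7 (i)(ii)) being a theorem of the tree, and no perf-factorial binder anywhere.
HONEST FRAMING: refereed pre-IUT material; a READING of a free interface slot, labelled in the theorem names; nothing
here asserts that such data exist for an actual curve; nothing here bears on [IUTchIII] Cor. 3.12; typed ≠ proved — here
PROVED at the reading.
-/

noncomputable section

namespace Literature.AnabelianGeometry.EtaleTheta

open CategoryTheory Opposite Literature.AlgebraicGeometry.Frobenioids Literature.AnabelianGeometry.SemiGraphs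

namespace BiKummerSetting

universe u₀ v₀ u v w

/-! ### The canonical weak-vocabulary models at the roots reading -/

section CanonicalTreeWeak

variable {K : Type u₀} [Field K] {K' : Type u₀} [Field K'] {D₀ : Type u₀} [Category.{v₀} D₀]
  {X₁ : SemiGraphs.TemperedArithmeticGroup.{u₀} K} {X₂ : SemiGraphs.TemperedArithmeticGroup.{u₀} K'}
  {D₀' : Type u₀} [Category.{v₀} D₀']
  {T₁ : RealifiedDivisorMonoids (D₀ := D₀) treeMonoidVocabWeak.{w}}
  {T₂ : RealifiedDivisorMonoids (D₀ := D₀') treeMonoidVocabWeak.{w}}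
  {D₁ D₂ : Type u} [Category.{v} D₁] [Category.{v} D₂]
  {IsRational₁ IsStrictlyRational₁ : (D₁ᵒᵖ ⥤ CommMonCat.{w}) → Prop}
  {IsRational₂ IsStrictlyRational₂ : (D₂ᵒᵖ ⥤ CommMonCat.{w}) → Prop}
  {tf₁ : TemperedFrobenioid T₁ D₁ (treeCatVocab D₁ IsRational₁ IsStrictlyRational₁)}
  {hZ₁ : tf₁.monoidType = MonoidType.Z} {hP₁ : ∀ A : D₁ᵒᵖ, IsPerfect (tf₁.Φ.carrier A)}
  {IG₁ : D₁ → Prop} {gS₁ : ∀ A : D₁, IG₁ A → (X₁.Pi →* Aut A)}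
  {gSs₁ : ∀ (A : D₁) (hA : IG₁ A), Function.Surjective (gS₁ A hA)} {A₀₁ : tf₁.category}
  {hA₀₁ : PreFrobenioid.IsFrobeniusTrivial tf₁.toElem A₀₁} {hA₀₁' : IG₁ A₀₁.base}
  {tf₂ : TemperedFrobenioid T₂ D₂ (treeCatVocab D₂ IsRational₂ IsStrictlyRational₂)}
  {hZ₂ : tf₂.monoidType = MonoidType.Z} {hP₂ : ∀ A : D₂ᵒᵖ, IsPerfect (tf₂.Φ.carrier A)}
  {IG₂ : D₂ → Prop} {gS₂ : ∀ A : D₂, IG₂ A → (X₂.Pi →* Aut A)}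
  {gSs₂ : ∀ (A : D₂) (hA : IG₂ A), Function.Surjective (gS₂ A hA)} {A₀₂ : tf₂.category}
  {hA₀₂ : PreFrobenioid.IsFrobeniusTrivial tf₂.toElem A₀₂} {hA₀₂' : IG₂ A₀₂.base}

/-- **T44-L14 "`Ψ` maps `N`-th roots of fraction-pairs to `N`-th roots" at the canonical WEAK-vocabulary model instances
AT THE ROOTS READING ⇐ {`Remark372 D₀ / D₀'` (Rmk 3.7.2), `hBmon₁ / hBmon₂`, T44-L09c `GaloisCompatible`} ONLY** —
`preservesNthRoots_mkOfModelCanonical_treeVocabWeak` with its T44-L15b binder DISCHARGED by abc-iut-w4-d044's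
`preservesNHSaturatedBsFld_rootsReading`; no perf-factorial binder (weak twin of
`preservesNthRoots_mkOfModelCanonical_rootsReading`). [cite: MochizukiEtTh2009, Thm 4.4 (ii) p.94] -/
theorem Thm44Hyp.preservesNthRoots_mkOfModelCanonical_rootsReading_treeVocabWeak
    (h : Thm44Hyp
      (mkOfModelCanonical X₁ tf₁ hZ₁ hP₁ IG₁ gS₁ gSs₁
        (fun _ A M => ∀ (g : A.base ⟶ A₀₁.base) (x : tf₁.ratFnFunctor.obj (op A₀₁.base)),
          divB tf₁.divisorMonoid tf₁.ratFnFunctor tf₁.divBNatTrans (op A₀₁.base) x = 1 →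
            ∃ ζ : tf₁.ratFnFunctor.obj (op A.base), ζ ^ (M : ℕ) = pull tf₁.ratFnFunctor g x)
        A₀₁ hA₀₁ hA₀₁')
      (mkOfModelCanonical X₂ tf₂ hZ₂ hP₂ IG₂ gS₂ gSs₂
        (fun _ A M => ∀ (g : A.base ⟶ A₀₂.base) (x : tf₂.ratFnFunctor.obj (op A₀₂.base)),
          divB tf₂.divisorMonoid tf₂.ratFnFunctor tf₂.divBNatTrans (op A₀₂.base) x = 1 →
            ∃ ζ : tf₂.ratFnFunctor.obj (op A.base), ζ ^ (M : ℕ) = pull tf₂.ratFnFunctor g x)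
        A₀₂ hA₀₂ hA₀₂'))
    (h372 : TemperedFrobenioid.Remark372 D₀) (h372' : TemperedFrobenioid.Remark372 D₀')
    (hBmon₁ : IsMonoidOn tf₁.ratFnFunctor) (hBmon₂ : IsMonoidOn tf₂.ratFnFunctor) (h9 : h.GaloisCompatible) :
    h.PreservesNthRoots (h.psiModel (tf₁.isFrobenioid_treeCatVocab_of_isMonoidOn hBmon₁)
      (tf₂.isFrobenioid_treeCatVocab_of_isMonoidOn hBmon₂)
      (h.preservesFrobeniusStructure_treeVocabWeak h372 h372' hBmon₁ hBmon₂))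
      (fun φ f => tf₁.pullFracModel φ f) (fun φ f => tf₂.pullFracModel φ f) :=
  h.preservesNthRoots_mkOfModelCanonical_treeVocabWeak h372 h372' hBmon₁ hBmon₂ h9
    (Thm44Hyp.preservesNHSaturatedBsFld_rootsReading tf₁ hZ₁ hP₁ IG₁ gS₁ gSs₁ A₀₁ hA₀₁ hA₀₁' tf₂ hZ₂ hP₂ IG₂ gS₂
      gSs₂ A₀₂ hA₀₂ hA₀₂' h (tf₁.isFrobenioid_treeCatVocab_of_isMonoidOn hBmon₁)
      (tf₂.isFrobenioid_treeCatVocab_of_isMonoidOn hBmon₂) (h.preservesFrobeniusStructure_treeVocabWeak h372 h372' hBmon₁ hBmon₂))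

/-- **[EtTh] Theorem 4.4 for the canonical WEAK-vocabulary model instances AT THE ROOTS READING, consolidated**:
(i) ∧ (ii) (fraction-pairs) ∧ (iii) (saturation) ∧ (ii) (`N`-th roots), for `ψ = Ψ^birat` (`psiModel`) and the model
pull-backs — modulo {Rmk 3.7.2 (`Remark372 D₀ / D₀'`), `hBmon₁ / hBmon₂`, T44-L09c `GaloisCompatible`, T44-L09
`HodotCompatible`}; T44-L15b discharged at the reading. [cite: MochizukiEtTh2009, Thm 4.4 p.94] -/
theorem Thm44Hyp.thm44_mkOfModelCanonical_rootsReading_treeVocabWeak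
    (h : Thm44Hyp
      (mkOfModelCanonical X₁ tf₁ hZ₁ hP₁ IG₁ gS₁ gSs₁
        (fun _ A M => ∀ (g : A.base ⟶ A₀₁.base) (x : tf₁.ratFnFunctor.obj (op A₀₁.base)),
          divB tf₁.divisorMonoid tf₁.ratFnFunctor tf₁.divBNatTrans (op A₀₁.base) x = 1 →
            ∃ ζ : tf₁.ratFnFunctor.obj (op A.base), ζ ^ (M : ℕ) = pull tf₁.ratFnFunctor g x)
        A₀₁ hA₀₁ hA₀₁')
      (mkOfModelCanonical X₂ tf₂ hZ₂ hP₂ IG₂ gS₂ gSs₂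
        (fun _ A M => ∀ (g : A.base ⟶ A₀₂.base) (x : tf₂.ratFnFunctor.obj (op A₀₂.base)),
          divB tf₂.divisorMonoid tf₂.ratFnFunctor tf₂.divBNatTrans (op A₀₂.base) x = 1 →
            ∃ ζ : tf₂.ratFnFunctor.obj (op A.base), ζ ^ (M : ℕ) = pull tf₂.ratFnFunctor g x)
        A₀₂ hA₀₂ hA₀₂'))
    (h372 : TemperedFrobenioid.Remark372 D₀) (h372' : TemperedFrobenioid.Remark372 D₀')
    (hBmon₁ : IsMonoidOn tf₁.ratFnFunctor) (hBmon₂ : IsMonoidOn tf₂.ratFnFunctor)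
    (h9c : h.GaloisCompatible) (h9 : h.HodotCompatible) :
    Thm44_i h ∧
      Thm44_ii h (h.psiModel (tf₁.isFrobenioid_treeCatVocab_of_isMonoidOn hBmon₁)
        (tf₂.isFrobenioid_treeCatVocab_of_isMonoidOn hBmon₂)
        (h.preservesFrobeniusStructure_treeVocabWeak h372 h372' hBmon₁ hBmon₂)) ∧
      Thm44_iii h (h.psiModel (tf₁.isFrobenioid_treeCatVocab_of_isMonoidOn hBmon₁)
        (tf₂.isFrobenioid_treeCatVocab_of_isMonoidOn hBmon₂)
        (h.preservesFrobeniusStructure_treeVocabWeak h372 h372' hBmon₁ hBmon₂)) ∧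
      h.PreservesNthRoots (h.psiModel (tf₁.isFrobenioid_treeCatVocab_of_isMonoidOn hBmon₁)
        (tf₂.isFrobenioid_treeCatVocab_of_isMonoidOn hBmon₂)
        (h.preservesFrobeniusStructure_treeVocabWeak h372 h372' hBmon₁ hBmon₂))
        (fun φ f => tf₁.pullFracModel φ f) (fun φ f => tf₂.pullFracModel φ f) :=
  h.thm44_mkOfModelCanonical_treeVocabWeak h372 h372' hBmon₁ hBmon₂ h9c h9
    (Thm44Hyp.preservesNHSaturatedBsFld_rootsReading tf₁ hZ₁ hP₁ IG₁ gS₁ gSs₁ A₀₁ hA₀₁ hA₀₁' tf₂ hZ₂ hP₂ IG₂ gS₂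
      gSs₂ A₀₂ hA₀₂ hA₀₂' h (tf₁.isFrobenioid_treeCatVocab_of_isMonoidOn hBmon₁)
      (tf₂.isFrobenioid_treeCatVocab_of_isMonoidOn hBmon₂) (h.preservesFrobeniusStructure_treeVocabWeak h372 h372' hBmon₁ hBmon₂))

end CanonicalTreeWeak

/-! ### At the genuine connected base `B^temp(Π^tp_X)⁰`, weak vocabulary, roots reading: `Remark372` + `hBmon` only -/

section ConnectedRoots

variable {K : Type u₀} [Field K] {K' : Type u₀} [Field K'] {X₁ : SemiGraphs.TemperedArithmeticGroup.{u₀} K}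
  {X₂ : SemiGraphs.TemperedArithmeticGroup.{u₀} K'} {D₀ : Type u₀} [Category.{v₀} D₀] {D₀' : Type u₀}
  [Category.{v₀} D₀'] {T₁ : RealifiedDivisorMonoids (D₀ := D₀) treeMonoidVocabWeak.{w}}
  {T₂ : RealifiedDivisorMonoids (D₀ := D₀') treeMonoidVocabWeak.{w}}
  {IsRational₁ IsStrictlyRational₁ : ((ConnectedPart (BTemp X₁.Pi))ᵒᵖ ⥤ CommMonCat.{w}) → Prop}
  {IsRational₂ IsStrictlyRational₂ : ((ConnectedPart (BTemp X₂.Pi))ᵒᵖ ⥤ CommMonCat.{w}) → Prop}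
  {tf₁ : TemperedFrobenioid T₁ (ConnectedPart (BTemp X₁.Pi))
    (treeCatVocab (ConnectedPart (BTemp X₁.Pi)) IsRational₁ IsStrictlyRational₁)}
  {hZ₁ : tf₁.monoidType = MonoidType.Z} {hP₁ : ∀ A : (ConnectedPart (BTemp X₁.Pi))ᵒᵖ, IsPerfect (tf₁.Φ.carrier A)}
  {A₁ : tf₁.category} {hA₁ : PreFrobenioid.IsFrobeniusTrivial tf₁.toElem A₁}
  {hA₁' : SemiGraphs.IsGaloisObj A₁.base.obj}
  {tf₂ : TemperedFrobenioid T₂ (ConnectedPart (BTemp X₂.Pi))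
    (treeCatVocab (ConnectedPart (BTemp X₂.Pi)) IsRational₂ IsStrictlyRational₂)}
  {hZ₂ : tf₂.monoidType = MonoidType.Z} {hP₂ : ∀ B : (ConnectedPart (BTemp X₂.Pi))ᵒᵖ, IsPerfect (tf₂.Φ.carrier B)}
  {A₂ : tf₂.category} {hA₂ : PreFrobenioid.IsFrobeniusTrivial tf₂.toElem A₂}
  {hA₂' : SemiGraphs.IsGaloisObj A₂.base.obj}

/-- **[EtTh] Theorem 4.4 at the genuine connected base `B^temp(Π^tp_X)⁰` over the WEAK vocabulary AT THE ROOTS READING of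
the `(N, H_⊙^{bs-fld})`-saturation slot, consolidated**: (i) ∧ (ii) (fraction-pairs) ∧ (iii) (saturation) ∧ (ii) (`N`-th
roots), for the settings `mkOfConnectedTemperoid` with `NH :=` the roots reading, realified data typed with
`treeMonoidVocabWeak`, the CONSTRUCTED `ψ = Ψ^birat` and the model pull-backs — **modulo ONLY {Rmk 3.7.2
(`Remark372 D₀ / D₀'`, named fact), `hBmon₁ / hBmon₂` (Def 3.6 (ii) datum "`𝔹` a monoid on `D`")}**: T44-L09/L09c by
[SemiAnbd] Prop 3.2 (abc-iut-w5-d013), T44-L15b at the roots reading (abc-iut-w4-d044), T44-L03/L04/L10/L12/L14 by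
[FrdI] Thm 3.4 / Cor 5.7 / Cor 4.10 / Thm 4.2 (ii) over slim FSM-type bases — all theorems of the tree, no
perf-factorial binder. [cite: MochizukiEtTh2009, Thm 4.4 p.94] -/
theorem Thm44Hyp.thm44_mkOfConnectedTemperoid_rootsReading_treeVocabWeak
    (h : Thm44Hyp
      (mkOfConnectedTemperoid X₁ tf₁ hZ₁ hP₁
        (fun _ A M => ∀ (g : A.base ⟶ A₁.base) (x : tf₁.ratFnFunctor.obj (op A₁.base)),
          divB tf₁.divisorMonoid tf₁.ratFnFunctor tf₁.divBNatTrans (op A₁.base) x = 1 →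
            ∃ ζ : tf₁.ratFnFunctor.obj (op A.base), ζ ^ (M : ℕ) = pull tf₁.ratFnFunctor g x)
        A₁ hA₁ hA₁')
      (mkOfConnectedTemperoid X₂ tf₂ hZ₂ hP₂
        (fun _ A M => ∀ (g : A.base ⟶ A₂.base) (x : tf₂.ratFnFunctor.obj (op A₂.base)),
          divB tf₂.divisorMonoid tf₂.ratFnFunctor tf₂.divBNatTrans (op A₂.base) x = 1 →
            ∃ ζ : tf₂.ratFnFunctor.obj (op A.base), ζ ^ (M : ℕ) = pull tf₂.ratFnFunctor g x)
        A₂ hA₂ hA₂'))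
    (h372 : TemperedFrobenioid.Remark372 D₀) (h372' : TemperedFrobenioid.Remark372 D₀')
    (hBmon₁ : IsMonoidOn tf₁.ratFnFunctor) (hBmon₂ : IsMonoidOn tf₂.ratFnFunctor) :
    Thm44_i h ∧
      Thm44_ii h (h.psiModel (tf₁.isFrobenioid_treeCatVocab_of_isMonoidOn hBmon₁)
        (tf₂.isFrobenioid_treeCatVocab_of_isMonoidOn hBmon₂)
        (h.preservesFrobeniusStructure_treeVocabWeak h372 h372' hBmon₁ hBmon₂)) ∧
      Thm44_iii h (h.psiModel (tf₁.isFrobenioid_treeCatVocab_of_isMonoidOn hBmon₁)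
        (tf₂.isFrobenioid_treeCatVocab_of_isMonoidOn hBmon₂)
        (h.preservesFrobeniusStructure_treeVocabWeak h372 h372' hBmon₁ hBmon₂)) ∧
      h.PreservesNthRoots (h.psiModel (tf₁.isFrobenioid_treeCatVocab_of_isMonoidOn hBmon₁)
        (tf₂.isFrobenioid_treeCatVocab_of_isMonoidOn hBmon₂)
        (h.preservesFrobeniusStructure_treeVocabWeak h372 h372' hBmon₁ hBmon₂))
        (fun φ f => tf₁.pullFracModel φ f) (fun φ f => tf₂.pullFracModel φ f) :=
  h.thm44_mkOfConnectedTemperoid_treeVocabWeak h372 h372' hBmon₁ hBmon₂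
    (Thm44Hyp.preservesNHSaturatedBsFld_rootsReading tf₁ hZ₁ hP₁ _ _ _ A₁ hA₁ hA₁' tf₂ hZ₂ hP₂ _ _ _ A₂ hA₂ hA₂' h
      (tf₁.isFrobenioid_treeCatVocab_of_isMonoidOn hBmon₁) (tf₂.isFrobenioid_treeCatVocab_of_isMonoidOn hBmon₂)
      (h.preservesFrobeniusStructure_treeVocabWeak h372 h372' hBmon₁ hBmon₂))

end ConnectedRoots

end BiKummerSetting

end Literature.AnabelianGeometry.EtaleTheta

end
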